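import Summits.QuantumFields.YangMills.Theses.LangevinControlUV
import Summits.QuantumFields.YangMills.Theorems.HypercubicLimit.Negative.AllTimesGapFalse
import Literature.MathematicalPhysics.QuantumLattice.GaugeGroupsProofs
import Literature.MathematicalPhysics.QuantumFieldTheory.LatticeGaugeProofs

/-!
# `OSLegsFromFemtoAndGap` — negative-side support: the units and gap legs are free; H1 is
# (cheaply) load-bearing; the scheme's tori are never femto; junk groups fail H1

Support file for crux `stmt-QuantumFields-9367`
(`Summit.QuantumFields.YangMills.Theses.LangevinControlUV.OSLegsFromFemtoAndGap`, route
LangevinControlUV, rank 6), extracted from the standing disprover's work file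
`Cruxes/OSLegsFromFemtoAndGap/Disproof.lean` §2–§5. Tree objects only, nothing posited; the
hypothesis bodies H1 (femto two-point package), H3 (gap in units `a`) of the crux are quoted
verbatim where needed.

* `hasLatticeMassGap_of_gapInUnits`: H3's clustering body re-indexed along ANY scheme in units
  `a` with `β_k ≥ β₂` and `L_k ≥ S₁(β_k)` eventually gives `HasLatticeMassGap r sch c₁`.
* `isYangMillsFor_vacuum_of_c_zero`, `concl_sans_nontriviality`: from `a > 0`,
  `a → 0` and H3 alone one gets a scheme in units `a`, OS data with `IsYangMillsFor` and a
  lattice gap — the conclusion of the crux minus `IsNontrivial ∧ IsNonGaussian`. All content of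
  the crux is the non-vacuum continuum limit.
* `osLegs_false_without_twoPoint`: with H1 dropped the crux is FALSE (unconditionally: `SU(2)`
  fundamental, unit map `a ≡ 0`); the clause isolated is the positivity of `a`.
* `scheme_tori_eventually_not_femto`: the scheme's own tori eventually violate every femto
  condition `side · a(β) ≤ ℓ₀`, so H1/H2 say nothing about the measures the conclusion uses.
* `not_twoPoint_of_subsingleton`: for a trivial gauge group H1 fails (all plaquette covariances
  vanish but H1 wants `0 < c Γ ≤ Cov` on the femto box `L = 8`): dropping
  `IsCompactSimpleLieGroup` opens no junk refutation. [folklore]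
-/

noncomputable section

open MeasureTheory Filter Topology
open Literature.MathematicalPhysics.AQFT Literature.MathematicalPhysics.QuantumLattice
open Literature.MathematicalPhysics.QuantumFieldTheory

namespace Summit.QuantumFields.YangMills.Theorems.OSLegsFromFemtoAndGap.Negative

section Units

variable {G : Type} [Group G] [TopologicalSpace G] [IsTopologicalGroup G] [CompactSpace G]
  [MeasurableSpace G] [BorelSpace G]

/-- **Re-indexing lemma.** The clustering body of H3 (`LatticeGapInUVUnits` for the unit map
`a`, witnesses `c₁, β₂, S₁`) gives `HasLatticeMassGap r sch c₁` for ANY scheme in units `a` whose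
couplings are eventually `≥ β₂` and whose half-sides eventually dominate `S₁(β_k)`. [folklore] -/
theorem hasLatticeMassGap_of_gapInUnits (r : LatticeRep G) {a : ℝ → ℝ} {c₁ β₂ : ℝ} {S₁ : ℝ → ℕ}
    (hgap : ∀ A B : YMSpecies G, ∃ C : ℝ, ∀ β : ℝ, β₂ ≤ β → ∀ S n : ℕ, S₁ β ≤ S → n ≤ S →
      |latticeConnectedCorr r.ρ β (2 * S + 1) A.F B.F n| ≤ C * Real.exp (-(c₁ * a β * n)))
    (sch : SpeciesScheme (YMSpecies G)) (ha : ∀ k, sch.a k = a (sch.β k))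
    (hβ : ∀ᶠ k in atTop, β₂ ≤ sch.β k) (hL : ∀ᶠ k in atTop, S₁ (sch.β k) ≤ sch.L k) :
    HasLatticeMassGap r sch c₁ := by
  intro A B
  obtain ⟨C, hC⟩ := hgap A B
  refine ⟨C, ?_⟩
  filter_upwards [hβ, hL] with k hk hLk
  intro S hS n hn
  have h := hC (sch.β k) hk S n (le_trans hLk hS) hn
  rw [ha k]
  simpa [mul_assoc] using h

/-- Zero renormalisations make every lattice Schwinger function of positive degree vanish. [folklore] -/
theorem latticeSchwinger_eq_zero_of_c_zero {N : ℕ} (ρ : G →* Matrix (Fin N) (Fin N) ℂ)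
    (sch : SpeciesScheme (YMSpecies G)) (hc : ∀ s k, sch.c s k = 0) (k n : ℕ) (hn : n ≠ 0)
    (σ : Fin n → YMSpecies G) (f : Fin n → SchwartzMap (EuclideanSpace ℝ (Fin 4)) ℝ) :
    latticeSchwinger ρ sch (fun s => s.F) k n σ f = 0 := by
  obtain ⟨j, rfl⟩ := Nat.exists_eq_succ_of_ne_zero hn
  simp [latticeSchwinger, smearedLatticeField, hc]

/-- With zero renormalisations the vacuum-only OS data satisfy `IsYangMillsFor` along ANY scheme
(generalises the tree's `isYangMillsFor_vacuum`). [folklore] -/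
theorem isYangMillsFor_vacuum_of_c_zero (r : LatticeRep G) (sch : SpeciesScheme (YMSpecies G))
    (hc : ∀ s k, sch.c s k = 0) : IsYangMillsFor r sch (OSData.vacuum (YMSpecies G) 4) := by
  intro n hn σ f F _ _
  have hS : (OSData.vacuum (YMSpecies G) 4).schwinger n σ F = 0 := by
    simp [OSData.vacuum, LabelledSchwingerFamily.trivial_of_ne_zero (YMSpecies G) hn]
  rw [hS]
  refine tendsto_const_nhds.congr' (Eventually.of_forall fun k => ?_)
  show (0 : ℂ) = ((latticeSchwinger r.ρ sch (fun s => s.F) k n σ f : ℝ) : ℂ)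
  rw [latticeSchwinger_eq_zero_of_c_zero r.ρ sch hc k n hn σ f]
  simp

/-- **Tightness: the conclusion of `OSLegsFromFemtoAndGap` minus `IsNontrivial ∧ IsNonGaussian`
follows from `a > 0`, `a → 0` and H3 alone** (vacuum OS data, zero renormalisations, the scheme
`β_k = β₂ + k`, `L_k = max (S₁ β_k) ⌈k / a(β_k)⌉₊`): a scheme in units `a`, `IsYangMillsFor`, and
`HasLatticeMassGap` at H3's rate. So
the units clause and the lattice-gap clause of the crux are free; all its content is a NON-vacuum
`T` tied to the lattice by `IsYangMillsFor` (E1, E0′, femto → large-torus decoupling). [folklore] -/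
theorem concl_sans_nontriviality (r : LatticeRep G) {a : ℝ → ℝ} (ha : ∀ β, 0 < a β)
    (hlim : Tendsto a atTop (𝓝 0))
    (h3 : ∃ (c₁ β₂ : ℝ) (S₁ : ℝ → ℕ), 0 < c₁ ∧ ∀ A B : YMSpecies G, ∃ C : ℝ, ∀ β : ℝ, β₂ ≤ β →
      ∀ S n : ℕ, S₁ β ≤ S → n ≤ S →
        |latticeConnectedCorr r.ρ β (2 * S + 1) A.F B.F n| ≤ C * Real.exp (-(c₁ * a β * n))) :
    ∃ (sch : SpeciesScheme (YMSpecies G)) (T : OSData (YMSpecies G) 4),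
      (∀ k, sch.a k = a (sch.β k)) ∧ IsYangMillsFor r sch T ∧ ∃ Δ > 0, HasLatticeMassGap r sch Δ := by
  obtain ⟨c₁, β₂, S₁, hc₁, hgap⟩ := h3
  -- the scheme in units `a`: β_k = β₂ + k, L_k = max (S₁ β_k) ⌈k / a(β_k)⌉₊ (so a_k L_k ≥ k),
  -- zero renormalisations
  let sch : SpeciesScheme (YMSpecies G) :=
    { a := fun k => a (β₂ + k)
      a_pos := fun k => ha _
      tendsto_a := hlim.comp (tendsto_atTop_add_const_left _ _ tendsto_natCast_atTop_atTop)
      β := fun k => β₂ + k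
      L := fun k => max (S₁ (β₂ + k)) ⌈(k : ℝ) / a (β₂ + k)⌉₊
      tendsto_L := by
        refine tendsto_atTop_mono (fun k => ?_) tendsto_natCast_atTop_atTop
        have hak := ha (β₂ + k)
        calc (k : ℝ) = a (β₂ + k) * ((k : ℝ) / a (β₂ + k)) := by field_simp
          _ ≤ a (β₂ + k) * (⌈(k : ℝ) / a (β₂ + k)⌉₊ : ℝ) :=
              mul_le_mul_of_nonneg_left (Nat.le_ceil _) hak.le
          _ ≤ a (β₂ + k) * ((max (S₁ (β₂ + k)) ⌈(k : ℝ) / a (β₂ + k)⌉₊ : ℕ) : ℝ) :=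
              mul_le_mul_of_nonneg_left (by exact_mod_cast le_max_right _ _) hak.le
      c := fun _ _ => 0
      m := fun _ _ => 0 }
  refine ⟨sch, OSData.vacuum _ 4, fun k => rfl,
    isYangMillsFor_vacuum_of_c_zero r sch (fun _ _ => rfl), c₁, hc₁, ?_⟩
  refine hasLatticeMassGap_of_gapInUnits r hgap sch (fun k => rfl)
    (Eventually.of_forall fun k => ?_) (Eventually.of_forall fun k => le_max_left _ _)
  show β₂ ≤ β₂ + k
  exact le_add_of_nonneg_right (Nat.cast_nonneg k)

/-- **The conclusion lives on non-femto tori.** For ANY scheme in units `a` and any femto radius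
`ℓ₀`, the scheme's own tori (side `2L_k+1`, coupling `β_k`) eventually violate the femto
condition `side · a(β) ≤ ℓ₀` under which H1/H2 speak (because `a_k L_k → ∞`): the dimension-8
amplitude on large tori ("decoupling") is an input the hypotheses of the crux do not contain. [folklore] -/
theorem scheme_tori_eventually_not_femto {ι : Type} (sch : SpeciesScheme ι) {a : ℝ → ℝ}
    (ha : ∀ k, sch.a k = a (sch.β k)) (ℓ₀ : ℝ) :
    ∀ᶠ k in atTop, ℓ₀ < (sch.side k : ℝ) * a (sch.β k) := by
  filter_upwards [sch.tendsto_L.eventually (eventually_gt_atTop ℓ₀)] with k hk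
  rw [← ha k]
  calc ℓ₀ < sch.a k * sch.L k := hk
    _ ≤ sch.a k * (sch.side k : ℝ) := by
        refine mul_le_mul_of_nonneg_left ?_ (sch.a_pos k).le
        unfold SpeciesScheme.side
        push_cast
        linarith [(Nat.cast_nonneg (sch.L k) : (0 : ℝ) ≤ _)]
    _ = (sch.side k : ℝ) * sch.a k := mul_comm _ _

end Units

/-! ## H1 is load-bearing (cheaply): the crux with the two-point package dropped is false -/

/-- `SU(2)` is a compact simple Lie group, unconditionally (the tree's named fact
`isSimpleCompactGroup_specialUnitaryGroup` is discharged by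
`isSimpleCompactGroup_specialUnitaryGroup_holds`). [cite: BrockerTomDieck1985, IV (3.1), IV (3.3) and V (8.7) Ex. 6] -/
theorem isCompactSimpleLieGroup_su2 :
    IsCompactSimpleLieGroup (Matrix.specialUnitaryGroup (Fin 2) ℂ) :=
  isCompactSimpleLieGroup_specialUnitaryGroup isSimpleCompactGroup_specialUnitaryGroup_holds le_rfl

/-- **`OSLegsFromFemtoAndGap` without H1 is false.** The statement obtained from the crux by
deleting the femto two-point package (keeping H2 = skewness witness and H3 = gap in units `a`,
verbatim) fails: at `G = SU(2)`, `r` fundamental and the unit map `a ≡ 0`, H2 holds with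
`Γ₃ = id` (it constrains `Γ₃` only on `(0, ℓ₁]`), H3 holds with rate `c₁ · 0` (torus correlations
of bounded observables are bounded, `abs_latticeConnectedCorr_le`), while every scheme has
`sch.a 0 > 0 ≠ a(β_0)`. Honest label: the clause of H1 isolated here is `∀ β, 0 < a β`; whether
the two-sided BOUNDS of H1 are used cannot be decided formally today (any witness of H1 ∧ H2 ∧ H3
proves the lattice mass gap at all weak couplings). [folklore] -/
theorem osLegs_false_without_twoPoint :
    ¬ (∀ (G : Type) [Group G] [TopologicalSpace G] [IsTopologicalGroup G] [CompactSpace G],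
        IsCompactSimpleLieGroup G →
          letI : MeasurableSpace G := borel G
          haveI : BorelSpace G := ⟨rfl⟩
          ∀ (r : LatticeRep G) (a : ℝ → ℝ),
            (∃ (Γ₃ : ℝ → ℝ) (β₁ ℓ₁ c₃ : ℝ), 0 < ℓ₁ ∧ 0 < c₃ ∧ (∀ s : ℝ, 0 < s → s ≤ ℓ₁ → 0 < Γ₃ s) ∧ ∀ (L : ℕ) [NeZero L] (β : ℝ), β₁ ≤ β → (L : ℝ) * a β ≤ ℓ₁ → let P : (Fin 4 → ZMod L) → Fin 4 → Fin 4 → GaugeConfig 4 L G → ℝ := fun x i j U => (r.N : ℝ) - (r.ρ (plaquetteHolonomy U x i j)).trace.re; let E : (GaugeConfig 4 L G → ℝ) → ℝ := fun F => wilsonExpectation (d := 4) (L := L) r.ρ β F; let cov : (GaugeConfig 4 L G → ℝ) → (GaugeConfig 4 L G → ℝ) → ℝ := fun F F' => E (fun U => F U * F' U) - E F * E F'; ∀ n : ℕ, 1 ≤ n → 8 * n ≤ L → c₃ * Γ₃ ((n : ℝ) * a β) ≤ (n : ℝ) ^ 12 * |E (fun U => P 0 0 1 U * P (Pi.single (2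 : Fin 4) ((n : ℕ) : ZMod L)) 0 1 U * P (Pi.single (3 : Fin 4) ((n : ℕ) : ZMod L)) 0 1 U) - E (P 0 0 1) * cov (P (Pi.single (2 : Fin 4) ((n : ℕ) : ZMod L)) 0 1) (P (Pi.single (3 : Fin 4) ((n : ℕ) : ZMod L)) 0 1) - E (P (Pi.single (2 : Fin 4) ((n : ℕ) : ZMod L)) 0 1) * cov (P 0 0 1) (P (Pi.single (3 : Fin 4) ((n : ℕ) : ZMod L)) 0 1) - E (P (Pi.single (3 : Fin 4) ((n : ℕ) : ZMod L)) 0 1) * cov (P 0 0 1) (P (Pi.single (2 : Fin 4) ((n : ℕ) : ZMod L)) 0 1) - E (P 0 0 1) * E (P (Pi.single (2 : Fin 4) ((n : ℕ) : ZMod L)) 0 1) * E (P (Pi.single (3 : Fin 4) ((n : ℕ) : ZMod L)) 0 1)|) →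
            (∃ (c₁ β₂ : ℝ) (S₁ : ℝ → ℕ), 0 < c₁ ∧ ∀ A B : YMSpecies G, ∃ C : ℝ, ∀ β : ℝ, β₂ ≤ β → ∀ S n : ℕ, S₁ β ≤ S → n ≤ S → |latticeConnectedCorr r.ρ β (2 * S + 1) A.F B.F n| ≤ C * Real.exp (-(c₁ * a β * n))) →
            ∃ (sch : SpeciesScheme (YMSpecies G)) (T : OSData (YMSpecies G) 4), (∀ k, sch.a k = a (sch.β k)) ∧ IsYangMillsFor r sch T ∧ T.IsNontrivial r.curvature ∧ T.IsNonGaussian r.curvature ∧ ∃ Δ > 0, HasLatticeMassGap r sch Δ) := by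
  intro h
  letI : MeasurableSpace (Matrix.specialUnitaryGroup (Fin 2) ℂ) := borel _
  haveI : BorelSpace (Matrix.specialUnitaryGroup (Fin 2) ℂ) := ⟨rfl⟩
  -- the fundamental representation of SU(2) as lattice representation data
  let r₂ : LatticeRep (Matrix.specialUnitaryGroup (Fin 2) ℂ) :=
    ⟨2, fundamentalRep (Fin 2), continuous_fundamentalRep _, fundamentalRep_injective _,
      fundamentalRep_mem_unitaryGroup⟩
  have h2 := h _ isCompactSimpleLieGroup_su2 r₂ (fun _ => 0)
  have hSk := fun hS hG => (h2 hS hG).elim fun sch hsch => hsch.elim fun T hT => (sch.a_pos 0).ne' (hT.1 0)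
  refine hSk ?_ ?_
  · refine ⟨fun s => s, 0, 1, 1, one_pos, one_pos, fun s hs _ => hs, ?_⟩
    intro L _ β _ _ P E cov n _ _
    simp only [mul_zero]
    positivity
  · refine ⟨1, 0, fun _ => 0, one_pos, fun A B => ?_⟩
    obtain ⟨CA, hCA⟩ := A.bounded
    obtain ⟨CB, hCB⟩ := B.bounded
    refine ⟨2 * (CA * CB), fun β _ S n _ _ => ?_⟩
    simpa using HypercubicLimit.Negative.abs_latticeConnectedCorr_le r₂ β (2 * S + 1) hCA hCB n

/-! ## Junk audit: trivial gauge groups fail H1 -/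

section Junk

variable {G : Type} [Group G] [TopologicalSpace G] [IsTopologicalGroup G] [CompactSpace G]
  [MeasurableSpace G] [BorelSpace G]

omit [TopologicalSpace G] [IsTopologicalGroup G] [CompactSpace G] [MeasurableSpace G] [BorelSpace G] in
/-- For a trivial gauge group the plaquette field `N − Re tr ρ(U_p)` vanishes identically. [folklore] -/
theorem plaquetteField_eq_zero_of_subsingleton [Subsingleton G] {N : ℕ}
    (ρ : G →* Matrix (Fin N) (Fin N) ℂ) {L : ℕ} (U : GaugeConfig 4 L G) (x : Fin 4 → ZMod L)
    (i j : Fin 4) : (N : ℝ) - (ρ (plaquetteHolonomy U x i j)).trace.re = 0 := by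
  rw [Subsingleton.elim (plaquetteHolonomy U x i j) 1, map_one, Matrix.trace_one]
  simp

/-- **No junk refutation through the gauge group.** For a trivial `G` (any `r`, any `a`) the
femto two-point package H1 of the crux (quoted verbatim) FAILS: all plaquette covariances vanish
while H1 demands `0 < c Γ(a β) ≤ Cov` on the femto torus `L = 8`, which exists since `a → 0`.
So at junk groups the crux holds vacuously; `IsCompactSimpleLieGroup` is not where a disprover
can bite. [folklore] -/
theorem not_twoPoint_of_subsingleton [Subsingleton G] (r : LatticeRep G) (a : ℝ → ℝ) :
    ¬ ∃ (Γ : ℝ → ℝ) (β₀ ℓ₀ c C : ℝ), 0 < ℓ₀ ∧ 0 < c ∧ (∀ β, 0 < a β) ∧ Filter.Tendsto a Filter.atTop (nhds 0) ∧ (∀ s : ℝ, 0 < s → s ≤ ℓ₀ → 0 < Γ s ∧ Γ s ≤ 1) ∧ ∀ (L : ℕ) [NeZero L] (β : ℝ), β₀ ≤ β → (L : ℝ) * a β ≤ ℓ₀ → let P : (Fin 4 → ZMod L) → Fin 4 → Fin 4 → GaugeConfig 4 L G → ℝ := fun x i j U => (r.N : ℝ) - (r.ρ (plaquetteHolonomy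 U x i j)).trace.re; let E : (GaugeConfig 4 L G → ℝ) → ℝ := fun F => wilsonExpectation (d := 4) (L := L) r.ρ β F; let cov : (GaugeConfig 4 L G → ℝ) → (GaugeConfig 4 L G → ℝ) → ℝ := fun F F' => E (fun U => F U * F' U) - E F * E F'; let dist : (Fin 4 → ZMod L) → (Fin 4 → ZMod L) → ℝ := fun x y => Real.sqrt (∑ k : Fin 4, (((x k - y k).valMinAbs : ℤ) : ℝ) ^ 2); (∀ n : ℕ, 1 ≤ n → 8 * n ≤ L → c * Γ ((n : ℝ) * a β) ≤ (n : ℝ) ^ 8 * cov (P 0 0 1) (P (Pi.single (2 : Fin 4) ((n : ℕ) : ZMod L)) 0 1) ∧ (n : ℝ) ^ 8 * cov (P 0 0 1) (P (Pi.single (2 : Fin 4) ((n : ℕ) : ZMod L)) 0 1) ≤ C * Γ ((n : ℝ) * a β)) ∧ (∀ (x y : Fin 4 → ZMod L) (i j i' j' : Fin 4), x ≠ y → i ≠ j → i' ≠ j' → |cov (P x i j) (P y i' j')| * dist x y ^ 8 ≤ C * Γ (dist x y * a β)) := by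
  rintro ⟨Γ, β₀, ℓ₀, c, C, hℓ, hc, hpos, hlim, hΓ, H⟩
  have hev : ∀ᶠ β in atTop, a β < ℓ₀ / 8 := hlim.eventually (gt_mem_nhds (by positivity))
  obtain ⟨β, hβ₀, hβ⟩ := ((eventually_ge_atTop β₀).and hev).exists
  have h8 : ((8 : ℕ) : ℝ) * a β ≤ ℓ₀ := by push_cast; linarith
  have hmain := ((H 8 β hβ₀ h8).1 1 le_rfl (by norm_num)).1
  simp only [plaquetteField_eq_zero_of_subsingleton, mul_zero, Nat.cast_one, one_mul,
    one_pow] at hmain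
  have hE : wilsonExpectation (d := 4) (L := 8) r.ρ β (fun _ : GaugeConfig 4 8 G => (0 : ℝ)) = 0 := by
    simp [wilsonExpectation]
  rw [hE] at hmain
  simp only [mul_zero, sub_self] at hmain
  have hΓpos := (hΓ (a β) (hpos β) (by linarith)).1
  have : 0 < c * Γ (a β) := mul_pos hc hΓpos
  linarith

end Junk

end Summit.QuantumFields.YangMills.Theorems.OSLegsFromFemtoAndGap.Negative

end
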